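import Mathlib.Analysis.InnerProductSpace.Harmonic.Constructions
import Mathlib.Analysis.SpecialFunctions.Log.Basic
import Mathlib.Analysis.Calculus.FDeriv.Symmetric
import Mathlib.Topology.Piecewise
import Literature.Topology.FourManifolds.MorseExtrema
import HarnessLib

/-!
# Stub `stub_bubbleConfinement` of line `Sketch` (pencil-incompleteness), crux `WitnessCharge`
(item stmt-SmoothPoincare4-7824, route `SullivanDual`) — part 1: **Liouville's theorem for
bounded subharmonic functions on `ℂ`**, in the elementary form the maximum principle of the
line needs.

Let `φ : ℂ → ℝ` be continuous, non-negative and bounded above, and assume that on the open set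
`{φ > 0}` it is `C²` with non-negative Laplacian (`InnerProductSpace.laplacian`, `Δ φ z ≥ 0`).
Then `φ` is constant (`subharmonic_liouville`).  (Such a `φ` is subharmonic on all of `ℂ`: it is
the maximum of the subharmonic function on `{φ > 0}` and the constant `0`.)

Proof (no potential theory, only the second-derivative test at a local maximum, the tree's
`Literature.Topology.FourManifolds.IsLocalMax.fderiv_fderiv_apply_self_nonpos`):

* `laplacian_nonpos_of_isLocalMax` — at a local maximum of a `C²` function `Δ ≤ 0`.
* `le_harmonic_of_le_on_compl` — **comparison principle**: `K` compact, `A ⊆ K` open, `H`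
  continuous on `K` and harmonic on `A`, `φ ≤ H` on `K ∖ A`; then `φ ≤ H` on `K`.  (Perturb by
  `δ‖z‖²`: an interior maximum `z₁` of `φ - H + δ‖z‖²` is impossible — if `φ z₁ > 0` the
  Laplacian there is `≥ 4δ > 0`, if `φ z₁ = 0` then `-H + δ‖z‖²` has a local maximum at `z₁`,
  again with Laplacian `4δ > 0`; let `δ → 0`.)
* `subharmonic_liouville` — fix `z₀`, `ε₀ > 0`, `r > 0` with `φ ≤ φ z₀ + ε₀` on `B̄(z₀, r)`
  (continuity).  On the annulus `r < ‖z - z₀‖ < R` compare with the harmonic function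
  `a + (B - a) log(‖z - z₀‖/r) / log(R/r)` (`a = φ z₀ + ε₀`, `B ≥ sup φ`; harmonicity of
  `log ‖z - z₀‖` is Mathlib's `AnalyticAt.harmonicAt_log_norm`) and let `R → ∞`: `φ ≤ φ z₀ + ε₀`
  everywhere.  Hence every point is a maximum point and `φ` is constant.

References: T. Ransford, *Potential theory in the complex plane*, LMS Student Texts 28 (1995),
Thm. 2.3.1 (maximum principle), Cor. 2.3.4 / Liouville for subharmonic functions
[Ransford1995]; M. Gromov, *Pseudo holomorphic curves in symplectic manifolds*, Invent. Math.
82 (1985), 2.3.D (maximum principle keeps `J`-curves out of pseudoconvex collars) [Gromov1985].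
-/

noncomputable section

-- the registered namespace `Summit.SmoothPoincare4.SmoothPoincare4.…` repeats a component
set_option linter.dupNamespace false

open scoped Topology RealInnerProductSpace
open Set Filter Metric Laplacian InnerProductSpace Complex

namespace Summit.SmoothPoincare4.SmoothPoincare4.Theorems.WitnessCharge.PencilIncompleteness

/-! ### The flat Laplacian on `ℂ` through iterated Fréchet derivatives -/

section Flat

variable {F : Type*} [NormedAddCommGroup F] [NormedSpace ℝ F]

/-- `Δ f (z) = D²f(z)(1, 1) + D²f(z)(i, i)` (Mathlib's Laplacian in the orthonormal basis
`(1, i)` of `ℂ`, second derivatives as `fderiv ℝ (fderiv ℝ f)`). [folklore] -/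
theorem laplacian_eq_fderiv_fderiv (f : ℂ → F) (z : ℂ) :
    Δ f z = fderiv ℝ (fderiv ℝ f) z 1 1 + fderiv ℝ (fderiv ℝ f) z I I := by
  rw [laplacian_eq_iteratedFDeriv_complexPlane]
  simp [iteratedFDeriv_two_apply]

/-- **Second-derivative test**: at a local maximum of a `C²` function `f : ℂ → ℝ` the Laplacian
is `≤ 0`. [folklore] -/
theorem laplacian_nonpos_of_isLocalMax {f : ℂ → ℝ} {z : ℂ} (hf : ContDiffAt ℝ 2 f z)
    (h : IsLocalMax f z) : Δ f z ≤ 0 := by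
  rw [laplacian_eq_fderiv_fderiv]
  have h1 := Literature.Topology.FourManifolds.IsLocalMax.fderiv_fderiv_apply_self_nonpos hf h 1
  have h2 := Literature.Topology.FourManifolds.IsLocalMax.fderiv_fderiv_apply_self_nonpos hf h I
  linarith

/-- The second derivative of `z ↦ ‖z‖²` on `ℂ` is `2⟪v, w⟫`. [folklore] -/
theorem fderiv_fderiv_norm_sq (z v w : ℂ) :
    fderiv ℝ (fderiv ℝ fun x : ℂ => ‖x‖ ^ 2) z v w = 2 * ⟪v, w⟫ := by
  have h : (fderiv ℝ fun x : ℂ => ‖x‖ ^ 2) = ⇑((2 : ℝ) • (innerSL ℝ : ℂ →L[ℝ] ℂ →L[ℝ] ℝ)) := by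
    funext x
    rw [(hasStrictFDerivAt_norm_sq x).hasFDerivAt.fderiv]
    ext y
    simp [two_smul]
  rw [h, ContinuousLinearMap.fderiv, FunLike.coe_smul, Pi.smul_apply, FunLike.coe_smul,
    Pi.smul_apply, innerSL_apply_apply, smul_eq_mul]

/-- `Δ ‖z‖² = 4` on `ℂ`. [folklore] -/
theorem laplacian_norm_sq_complex (z : ℂ) : Δ (fun x : ℂ => ‖x‖ ^ 2) z = 4 := by
  rw [laplacian_eq_fderiv_fderiv, fderiv_fderiv_norm_sq, fderiv_fderiv_norm_sq,
    real_inner_self_eq_norm_sq, real_inner_self_eq_norm_sq]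
  simp
  norm_num

/-- `z ↦ ‖z‖²` is smooth on `ℂ`. [folklore] -/
theorem contDiff_norm_sq_complex {n : WithTop ℕ∞} : ContDiff ℝ n fun x : ℂ => ‖x‖ ^ 2 :=
  contDiff_norm_sq ℝ

/-- Laplacian of the perturbed comparison function `f - H + δ‖z‖²`. [folklore] -/
theorem laplacian_sub_add_norm_sq {f H : ℂ → ℝ} {z : ℂ} (δ : ℝ) (hf : ContDiffAt ℝ 2 f z)
    (hH : ContDiffAt ℝ 2 H z) :
    Δ (fun x => f x - H x + δ * ‖x‖ ^ 2) z = Δ f z - Δ H z + 4 * δ := by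
  have hq : ContDiffAt ℝ 2 (fun x : ℂ => ‖x‖ ^ 2) z := contDiff_norm_sq_complex.contDiffAt
  have hfun : (fun x => f x - H x + δ * ‖x‖ ^ 2) = (f - H) + δ • fun x : ℂ => ‖x‖ ^ 2 := by
    funext x
    simp [smul_eq_mul]
  have hfH : ContDiffAt ℝ 2 (f - H) z := hf.sub hH
  have hq' : ContDiffAt ℝ 2 (δ • fun x : ℂ => ‖x‖ ^ 2) z := hq.const_smul δ
  rw [hfun, hfH.laplacian_add hq', hf.laplacian_sub hH, laplacian_smul δ hq,
    laplacian_norm_sq_complex]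
  simp [smul_eq_mul]
  ring

/-- The perturbed comparison function is `C²` where `f` and `H` are. [folklore] -/
theorem contDiffAt_sub_add_norm_sq {f H : ℂ → ℝ} {z : ℂ} (δ : ℝ) (hf : ContDiffAt ℝ 2 f z)
    (hH : ContDiffAt ℝ 2 H z) : ContDiffAt ℝ 2 (fun x => f x - H x + δ * ‖x‖ ^ 2) z :=
  (hf.sub hH).add (contDiffAt_const.mul contDiff_norm_sq_complex.contDiffAt)

end Flat

/-! ### The comparison principle -/

/-- **Comparison principle.**  Let `φ : ℂ → ℝ` be continuous, non-negative, and `C²` with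
`Δ φ ≥ 0` at every point where `φ > 0`.  Let `K` be compact, `A ⊆ K` open, `H` continuous on `K`
and harmonic on `A`, and `φ ≤ H` on `K ∖ A`.  Then `φ ≤ H` on `K`. [cite: Ransford1995, Thm. 2.3.1] -/
theorem le_harmonic_of_le_on_compl {φ H : ℂ → ℝ} {K A : Set ℂ} (hK : IsCompact K)
    (hA : IsOpen A) (hAK : A ⊆ K) (hφc : Continuous φ) (hφ0 : ∀ z, 0 ≤ φ z)
    (hφ2 : ∀ z, 0 < φ z → ContDiffAt ℝ 2 φ z) (hφΔ : ∀ z, 0 < φ z → 0 ≤ Δ φ z)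
    (hHc : ContinuousOn H K) (hH : ∀ z ∈ A, HarmonicAt H z)
    (hle : ∀ z ∈ K, z ∉ A → φ z ≤ H z) : ∀ z ∈ K, φ z ≤ H z := by
  intro z hz
  obtain ⟨R₀, hR₀⟩ : ∃ R₀, ∀ x ∈ K, ‖x‖ ≤ R₀ := hK.isBounded.exists_norm_le
  apply le_of_forall_pos_le_add
  intro ε hε
  -- the size of the perturbation
  set δ : ℝ := ε / (R₀ ^ 2 + 1) with hδ
  have hR₀1 : 0 < R₀ ^ 2 + 1 := by positivity
  have hδpos : 0 < δ := div_pos hε hR₀1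
  have hδR : δ * R₀ ^ 2 ≤ ε := by
    rw [hδ, div_mul_eq_mul_div, div_le_iff₀ hR₀1]
    nlinarith
  -- the perturbed function and its maximum on `K`
  set ψ : ℂ → ℝ := fun x => φ x - H x + δ * ‖x‖ ^ 2 with hψ
  have hψc : ContinuousOn ψ K :=
    (hφc.continuousOn.sub hHc).add ((continuous_const.mul (continuous_norm.pow 2)).continuousOn)
  obtain ⟨z₁, hz₁K, hmax⟩ := hK.exists_isMaxOn ⟨z, hz⟩ hψc
  by_cases hz₁A : z₁ ∈ A
  · -- an interior maximum is impossible
    exfalso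
    have hloc : IsLocalMax ψ z₁ := hmax.isLocalMax (mem_of_superset (hA.mem_nhds hz₁A) hAK)
    have hH₁ : HarmonicAt H z₁ := hH z₁ hz₁A
    have hH0 : Δ H z₁ = 0 := hH₁.2.eq_of_nhds
    rcases (hφ0 z₁).lt_or_eq with hpos | hzero
    · have hφ₁ := hφ2 z₁ hpos
      have hψ2 : ContDiffAt ℝ 2 ψ z₁ := contDiffAt_sub_add_norm_sq δ hφ₁ hH₁.1
      have hΔψ : Δ ψ z₁ = Δ φ z₁ - Δ H z₁ + 4 * δ := laplacian_sub_add_norm_sq δ hφ₁ hH₁.1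
      have hnonpos := laplacian_nonpos_of_isLocalMax hψ2 hloc
      have := hφΔ z₁ hpos
      linarith
    · set g : ℂ → ℝ := fun x => (0 : ℝ) - H x + δ * ‖x‖ ^ 2 with hg
      have hgloc : IsLocalMax g z₁ := by
        filter_upwards [hloc] with x hx
        have hx' : φ x - H x + δ * ‖x‖ ^ 2 ≤ φ z₁ - H z₁ + δ * ‖z₁‖ ^ 2 := hx
        have h0x := hφ0 x
        show (0 : ℝ) - H x + δ * ‖x‖ ^ 2 ≤ 0 - H z₁ + δ * ‖z₁‖ ^ 2
        linarith
      have hg2 : ContDiffAt ℝ 2 g z₁ := contDiffAt_sub_add_norm_sq δ contDiffAt_const hH₁.1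
      have hΔg : Δ g z₁ = Δ (fun _ : ℂ => (0 : ℝ)) z₁ - Δ H z₁ + 4 * δ :=
        laplacian_sub_add_norm_sq δ contDiffAt_const hH₁.1
      have hc0 : Δ (fun _ : ℂ => (0 : ℝ)) z₁ = 0 := by
        rw [laplacian_const]; rfl
      have hnonpos := laplacian_nonpos_of_isLocalMax hg2 hgloc
      linarith
  · -- the maximum is on `K ∖ A`, where `φ ≤ H`
    have h1 : ψ z ≤ ψ z₁ := hmax hz
    have h2 : φ z₁ ≤ H z₁ := hle z₁ hz₁K hz₁A
    have h3 : δ * ‖z₁‖ ^ 2 ≤ δ * R₀ ^ 2 :=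
      mul_le_mul_of_nonneg_left (pow_le_pow_left₀ (norm_nonneg _) (hR₀ z₁ hz₁K) 2) hδpos.le
    have h4 : 0 ≤ δ * ‖z‖ ^ 2 := by positivity
    have h1' : φ z - H z + δ * ‖z‖ ^ 2 ≤ φ z₁ - H z₁ + δ * ‖z₁‖ ^ 2 := h1
    linarith

/-! ### Liouville's theorem for bounded subharmonic functions -/

/-- The harmonic comparison function `a + c (log ‖z - z₀‖ - log r)` on an annulus. [folklore] -/
theorem harmonicAt_logComparison (a c r : ℝ) {z₀ z : ℂ} (hz : z ≠ z₀) :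
    HarmonicAt (fun y : ℂ => a + c * (Real.log ‖y - z₀‖ - Real.log r)) z := by
  have hlog : HarmonicAt (fun y : ℂ => Real.log ‖y - z₀‖) z :=
    (analyticAt_id.sub analyticAt_const).harmonicAt_log_norm (sub_ne_zero.2 hz)
  have hfun : (fun y : ℂ => a + c * (Real.log ‖y - z₀‖ - Real.log r)) =
      (fun _ => a) + c • ((fun y : ℂ => Real.log ‖y - z₀‖) - fun _ => Real.log r) := by
    funext y
    simp [smul_eq_mul]
  rw [hfun]
  exact (harmonicAt_const a).add (hlog.sub (harmonicAt_const _)).const_smul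

/-- **Every point is a maximum point.**  Under the hypotheses of `subharmonic_liouville`,
`φ z ≤ φ z₀` for all `z₀, z` (Hadamard-type comparison with `a + b log ‖z - z₀‖` on annuli
`r < ‖z - z₀‖ < R`, `R → ∞`). [cite: Ransford1995, Cor. 2.3.4] -/
theorem le_of_subharmonic_bounded {φ : ℂ → ℝ} (hc : Continuous φ) (h0 : ∀ z, 0 ≤ φ z)
    (hb : BddAbove (range φ)) (h2 : ∀ z, 0 < φ z → ContDiffAt ℝ 2 φ z)
    (hΔ : ∀ z, 0 < φ z → 0 ≤ Δ φ z) (z₀ z : ℂ) : φ z ≤ φ z₀ := by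
  apply le_of_forall_pos_le_add
  intro ε₀ hε₀
  -- a radius on which `φ ≤ φ z₀ + ε₀`
  obtain ⟨r₁, hr₁, hr₁φ⟩ := Metric.continuous_iff.1 hc z₀ ε₀ hε₀
  set r : ℝ := r₁ / 2 with hr_def
  have hr : 0 < r := by positivity
  have hrφ : ∀ x : ℂ, ‖x - z₀‖ ≤ r → φ x ≤ φ z₀ + ε₀ := by
    intro x hx
    have hd : dist x z₀ < r₁ := by
      rw [dist_eq_norm]; linarith
    have := hr₁φ x hd
    rw [Real.dist_eq] at this
    linarith [(abs_sub_lt_iff.1 this).1]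
  by_cases hzr : ‖z - z₀‖ ≤ r
  · exact hrφ z hzr
  push Not at hzr
  obtain ⟨B, hB⟩ := hb
  have hBφ : ∀ x, φ x ≤ B := fun x => hB ⟨x, rfl⟩
  set a : ℝ := φ z₀ + ε₀ with ha_def
  set B' : ℝ := max B a with hB'_def
  set d : ℝ := ‖z - z₀‖ with hd_def
  -- comparison on the annuli `r < ‖· - z₀‖ < R`
  have key : ∀ R : ℝ, d < R →
      φ z ≤ a + (B' - a) * (Real.log d - Real.log r) / (Real.log R - Real.log r) := by
    intro R hR
    have hrR : r < R := hzr.trans hR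
    have hlog : Real.log r < Real.log R := Real.log_lt_log hr hrR
    set L : ℝ := Real.log R - Real.log r with hL_def
    have hLpos : 0 < L := sub_pos.2 hlog
    set c : ℝ := (B' - a) / L with hc_def
    set H : ℂ → ℝ := fun x => a + c * (Real.log ‖x - z₀‖ - Real.log r) with hH_def
    set K : Set ℂ := {x | r ≤ ‖x - z₀‖ ∧ ‖x - z₀‖ ≤ R} with hK_def
    set A : Set ℂ := {x | r < ‖x - z₀‖ ∧ ‖x - z₀‖ < R} with hA_def
    have hnc : Continuous fun x : ℂ => ‖x - z₀‖ := (continuous_id.sub continuous_const).norm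
    have hK : IsCompact K := by
      apply Metric.isCompact_of_isClosed_isBounded
      · exact isClosed_Icc.preimage hnc
      · refine (isBounded_closedBall (x := z₀) (r := R)).subset fun x hx => ?_
        rw [mem_closedBall, dist_eq_norm]
        exact hx.2
    have hA : IsOpen A := isOpen_Ioo.preimage hnc
    have hAK : A ⊆ K := fun x hx => ⟨hx.1.le, hx.2.le⟩
    have hHc : ContinuousOn H K := by
      intro x hx
      apply ContinuousAt.continuousWithinAt
      have hx0 : ‖x - z₀‖ ≠ 0 := (hr.trans_le hx.1).ne'
      exact continuousAt_const.add
        (continuousAt_const.mul ((hnc.continuousAt.log hx0).sub continuousAt_const))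
    have hHh : ∀ x ∈ A, HarmonicAt H x := by
      intro x hx
      have hx0 : x ≠ z₀ := by
        intro h
        have hx1 : r < ‖x - z₀‖ := hx.1
        rw [h, sub_self, norm_zero] at hx1
        linarith
      exact harmonicAt_logComparison a c r hx0
    have hle : ∀ x ∈ K, x ∉ A → φ x ≤ H x := by
      intro x hxK hxA
      have hcases : ‖x - z₀‖ = r ∨ ‖x - z₀‖ = R := by
        by_contra hne
        push Not at hne
        exact hxA ⟨lt_of_le_of_ne hxK.1 (Ne.symm hne.1), lt_of_le_of_ne hxK.2 hne.2⟩
      rcases hcases with h | h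
      · have hHx : H x = a := by
          simp [hH_def, h]
        rw [hHx]
        exact hrφ x h.le
      · have hHx : H x = B' := by
          show a + c * (Real.log ‖x - z₀‖ - Real.log r) = B'
          rw [h, ← hL_def, hc_def, div_mul_cancel₀ _ hLpos.ne']
          ring
        rw [hHx]
        exact (hBφ x).trans (le_max_left _ _)
    have hzK : z ∈ K := ⟨hzr.le, hR.le⟩
    have hmain := le_harmonic_of_le_on_compl hK hA hAK hc h0 h2 hΔ hHc hHh hle z hzK
    have hHz : H z = a + (B' - a) * (Real.log d - Real.log r) / L := by
      simp only [hH_def, hc_def, hd_def]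
      ring
    rwa [hHz] at hmain
  -- let `R → ∞`
  have hlim : Tendsto (fun R : ℝ =>
      a + (B' - a) * (Real.log d - Real.log r) / (Real.log R - Real.log r)) atTop (𝓝 a) := by
    have h1 : Tendsto (fun R : ℝ => Real.log R - Real.log r) atTop atTop := by
      simpa only [sub_eq_add_neg] using
        tendsto_atTop_add_const_right atTop (-Real.log r) Real.tendsto_log_atTop
    have h2 := h1.inv_tendsto_atTop
    have h3 := (h2.const_mul ((B' - a) * (Real.log d - Real.log r))).const_add a
    simp only [mul_zero, add_zero] at h3
    refine h3.congr' (Eventually.of_forall fun R => ?_)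
    simp [div_eq_mul_inv]
  exact ge_of_tendsto hlim ((eventually_gt_atTop d).mono key)

/-- **Liouville's theorem for bounded subharmonic functions (elementary form).**  A continuous,
non-negative, bounded function `φ : ℂ → ℝ` which is `C²` with `Δ φ ≥ 0` wherever it is positive
is constant. [cite: Ransford1995, Cor. 2.3.4] -/
theorem subharmonic_liouville {φ : ℂ → ℝ} (hc : Continuous φ) (h0 : ∀ z, 0 ≤ φ z)
    (hb : BddAbove (range φ)) (h2 : ∀ z, 0 < φ z → ContDiffAt ℝ 2 φ z)
    (hΔ : ∀ z, 0 < φ z → 0 ≤ Δ φ z) (z w : ℂ) : φ z = φ w :=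
  le_antisymm (le_of_subharmonic_bounded hc h0 hb h2 hΔ w z)
    (le_of_subharmonic_bounded hc h0 hb h2 hΔ z w)

/-- Registered sub-goal form of `subharmonic_liouville` (explicit binders, Mathlib's
`Laplacian.laplacian`): a continuous, non-negative, bounded `φ : ℂ → ℝ`, `C²` with `Δ φ ≥ 0`
where positive, is constant. [cite: Ransford1995, Cor. 2.3.4] -/
theorem stub_bubbleConfinement_subharmonicLiouville :
    ∀ (φ : ℂ → ℝ), Continuous φ → (∀ z : ℂ, 0 ≤ φ z) → BddAbove (Set.range φ) →
      (∀ z : ℂ, 0 < φ z → ContDiffAt ℝ 2 φ z) →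
      (∀ z : ℂ, 0 < φ z → 0 ≤ Laplacian.laplacian φ z) → ∀ z w : ℂ, φ z = φ w :=
  fun _ hc h0 hb h2 hΔ z w => subharmonic_liouville hc h0 hb h2 hΔ z w

end Summit.SmoothPoincare4.SmoothPoincare4.Theorems.WitnessCharge.PencilIncompleteness
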